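import Literature.AnabelianGeometry.EtaleTheta.FrobenioidMonoThetaEnv
import Mathlib.Tactic.Group

/-!
# [EtTh] §5, Lemma 5.9 (iv): the group isomorphism `E^Π_N ⥲ Π^tp_Y̲[μ_N]` PROVED modulo the cyclotomic character (p. 332 / PDF p. 106)

Mochizuki, *The étale theta function …*, Publ. RIMS **45** (2009)
[cite: MochizukiEtTh2009, Lem 5.9 (iv) p.332 (PDF p.106)].  Seat abc-iut-L2-t4.  Lemma 5.9 (iv):
"the natural inclusions `μ_N(B_N) ↪ E_N`, `Im(Π^tp_Y) ⊆ E_N` determine an isomorphism of topological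
groups `E^Π_N ⥲ Π^tp_Y[μ_N]`".  Here the GROUP isomorphism is CONSTRUCTED and PROVED
(`envHom`, `envHom_bijective`, `envIso`) from the §5 data `ThetaFrobenioid` onto abc-iut-L2-t2's
cyclotomic envelope `T.env = μ_N ⋊ Π^tp_Y` (`CycEnvelope T.augY T.chi`, Def. 2.10), modulo:
the bundled printed facts `ThetaFrobenioid.Facts` (section property of `s^⊓-gp_N`, `O^×(B_N) = Ker`,
…), an identification `ι : Π^tp_X̲ ≃ T.PiX` carrying `Π^tp_Y̲` onto `T.PiY` (`IdentifiesPiY`, pending the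
merge of the two interfaces), an identification of cyclotomes `m : μ_N(B_N) ≃ μ_N`, and the one
arithmetic input `CyclotomicCharacterCompat`: "`Π^tp_Y` acts on `μ_N(B_N)` [by conjugation through
`s^⊓-gp_N ∘ ρ`] via the cyclotomic character" (the `G_K`-module structure of the roots of unity of
`O^×(B_N)`; [FrdII] Def. 2.1 (i) / Thm. 2.4 — a FACT here).  The map: `(e, y) ↦ (e · s^⊓-gp_N(ρ y)⁻¹, y)`
— its first component lies in `μ_N(B_N) = E_N ∩ Ker` by Lemma 5.9 (ii).  Compatibilities PROVED:
with the projections to `Π^tp_Y̲` (`envIso_proj`), with the inclusions of `μ_N` (`envIso_muIncl`), and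
`s^⊓-Π_N ↦ s^alg` (`envIso_sCapPi`) — i.e. the `s^alg`-half of "isomorphism of bi-theta environments";
the `s^Θ`-half is Prop. 5.2 (iii) (`ThetaPairKummerClass`) and the `D`-half involves the Kummer
classes of constants (Lemma 5.8), both typed elsewhere.  Continuity is not treated in this file (both
topologies are "`μ_N` discrete × `Π^tp_Y`"; recorded, not proved).  HONEST FRAMING: a discharge
modulo the named hypotheses listed; nothing of [EtTh] is asserted unconditionally.
-/

namespace Literature.AnabelianGeometry.EtaleTheta

open CategoryTheory

universe w v v' u u'

namespace ThetaFrobenioid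

variable {C : Type u} [Category.{v} C] {D : Type u'} [Category.{v'} D] (𝔉 : ThetaFrobenioid.{w} C D)

/-- The identification `ι : Π^tp_X̲ ≃ T.PiX` "carries `Π^tp_Y̲` onto `Π^tp_Y`" (the same subgroup seen in
the two interfaces; `TODO-merge(abc-iut-L2-t2)`).  [cite: MochizukiEtTh2009, Lem 5.9 (iv) p.332 (PDF p.106)] -/
def IdentifiesPiY (T : ThetaEnvData.{v} 𝔉.N) (ι : 𝔉.PiX ≃* T.PiX) : Prop :=
  ∀ y : 𝔉.PiX, y ∈ 𝔉.PiY ↔ ι y ∈ T.PiY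

/-- "`Π^tp_Y` acts on `μ_N(B_N)` via the cyclotomic character": conjugation by `s^⊓-gp_N(ρ y)` on
`μ_N(B_N)` corresponds under `m : μ_N(B_N) ≃ μ_N` to `χ(aug(ι y))` (the mod-`N` cyclotomic character of
abc-iut-L2-t2's `ThetaEnvData`).  Arithmetic FACT ([FrdII] Def. 2.1 (i), Thm. 2.4; [EtTh] p.331
(PDF p.105) "`Π^tp_Y` [i.e., `G_K` …] acts via multiplication by …").
[cite: MochizukiEtTh2009, Lem 5.8 proof p.331 (PDF p.105)] -/
def CyclotomicCharacterCompat (T : ThetaEnvData.{v} 𝔉.N) (ι : 𝔉.PiX ≃* T.PiX)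
    (m : 𝔉.muTorsion 𝔉.BN 𝔉.N ≃* T.mu) : Prop :=
  ∀ y : 𝔉.PiX, y ∈ 𝔉.PiY → ∀ u u' : 𝔉.muTorsion 𝔉.BN 𝔉.N,
    (u' : Aut 𝔉.BN) = 𝔉.sgpCap (𝔉.ρ y) * u * (𝔉.sgpCap (𝔉.ρ y))⁻¹ → m u' = T.chi (T.aug (ι y)) (m u)

section

/-- The `μ_N(B_N)`-component of `x = (e, y) ∈ E^Π_N`: `e · s^⊓-gp_N(ρ y)⁻¹`, which lies in
`E_N ∩ Ker(Aut_C(B_N) → Aut_D(B_N^bs)) = μ_N(B_N)` (Lemma 5.9 (ii)).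
[cite: MochizukiEtTh2009, Lem 5.9 (iv) p.332 (PDF p.106)] -/
def unitPart (H : 𝔉.Facts) (x : 𝔉.EPiN) : 𝔉.muTorsion 𝔉.BN 𝔉.N :=
  ⟨x.1.1 * (𝔉.sgpCap (𝔉.ρ x.1.2))⁻¹, by
    rw [← (H.enExact).2]
    refine Subgroup.mem_inf.mpr ⟨𝔉.EN.mul_mem x.2.1 (𝔉.EN.inv_mem (𝔉.sgpCap_rho_mem_EN x.2.2.1)), ?_⟩
    rw [MonoidHom.mem_ker, map_mul, map_inv, H.sgpCapSection, x.2.2.2, mul_inv_cancel]⟩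

/-- Value of `unitPart`. [cite: MochizukiEtTh2009, Lem 5.9 (iv) p.332 (PDF p.106)] -/
@[simp] theorem coe_unitPart (H : 𝔉.Facts) (x : 𝔉.EPiN) :
    ((𝔉.unitPart H x : 𝔉.muTorsion 𝔉.BN 𝔉.N) : Aut 𝔉.BN) = x.1.1 * (𝔉.sgpCap (𝔉.ρ x.1.2))⁻¹ := rfl

/-- **The homomorphism `E^Π_N → Π^tp_Y[μ_N]`**, `(e, y) ↦ (m(e · s^⊓-gp_N(ρ y)⁻¹), ι y)` into
abc-iut-L2-t2's `CycEnvelope T.augY T.chi = μ_N ⋊ Π^tp_Y` ("determined by the natural inclusions",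
Lemma 5.9 (iv)).  [cite: MochizukiEtTh2009, Lem 5.9 (iv) p.332 (PDF p.106)] -/
def envHom (H : 𝔉.Facts) (T : ThetaEnvData.{v} 𝔉.N) (ι : 𝔉.PiX ≃* T.PiX)
    (m : 𝔉.muTorsion 𝔉.BN 𝔉.N ≃* T.mu) (hY : 𝔉.IdentifiesPiY T ι)
    (hχ : 𝔉.CyclotomicCharacterCompat T ι m) : 𝔉.EPiN →* T.env where
  toFun x := ⟨m (𝔉.unitPart H x), ⟨ι x.1.2, (hY _).mp x.2.2.1⟩⟩
  map_one' := by
    have h1 : 𝔉.unitPart H 1 = 1 := Subtype.ext (by simp)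
    ext
    · simp [h1]
    · simp
  map_mul' a b := by
    let c : 𝔉.muTorsion 𝔉.BN 𝔉.N :=
      ⟨𝔉.sgpCap (𝔉.ρ a.1.2) * (𝔉.unitPart H b : Aut 𝔉.BN) * (𝔉.sgpCap (𝔉.ρ a.1.2))⁻¹,
        (𝔉.muTorsion_normal 𝔉.BN 𝔉.N).conj_mem _ (𝔉.unitPart H b).2 _⟩
    have hab : 𝔉.unitPart H (a * b) = 𝔉.unitPart H a * c := by
      apply Subtype.ext
      change (a.1 * b.1).1 * (𝔉.sgpCap (𝔉.ρ (a.1 * b.1).2))⁻¹ =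
        (a.1.1 * (𝔉.sgpCap (𝔉.ρ a.1.2))⁻¹) *
          (𝔉.sgpCap (𝔉.ρ a.1.2) * (b.1.1 * (𝔉.sgpCap (𝔉.ρ b.1.2))⁻¹) * (𝔉.sgpCap (𝔉.ρ a.1.2))⁻¹)
      simp only [Prod.fst_mul, Prod.snd_mul, map_mul, mul_inv_rev]
      group
    have hc : m c = T.chi (T.aug (ι a.1.2)) (m (𝔉.unitPart H b)) :=
      hχ a.1.2 a.2.2.1 (𝔉.unitPart H b) c rfl
    ext
    · change m (𝔉.unitPart H (a * b)) = m (𝔉.unitPart H a) * T.chi (T.aug (ι a.1.2)) (m (𝔉.unitPart H b))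
      rw [hab, map_mul, hc]
    · change ι (a.1 * b.1).2 = ι a.1.2 * ι b.1.2
      simp

/-- `envHom` on elements. [cite: MochizukiEtTh2009, Lem 5.9 (iv) p.332 (PDF p.106)] -/
theorem envHom_apply_left (H : 𝔉.Facts) (T : ThetaEnvData.{v} 𝔉.N) (ι : 𝔉.PiX ≃* T.PiX)
    (m : 𝔉.muTorsion 𝔉.BN 𝔉.N ≃* T.mu) (hY : 𝔉.IdentifiesPiY T ι)
    (hχ : 𝔉.CyclotomicCharacterCompat T ι m) (x : 𝔉.EPiN) : (𝔉.envHom H T ι m hY hχ x).left = m (𝔉.unitPart H x) := rfl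

/-- `envHom` on elements. [cite: MochizukiEtTh2009, Lem 5.9 (iv) p.332 (PDF p.106)] -/
theorem envHom_apply_right (H : 𝔉.Facts) (T : ThetaEnvData.{v} 𝔉.N) (ι : 𝔉.PiX ≃* T.PiX)
    (m : 𝔉.muTorsion 𝔉.BN 𝔉.N ≃* T.mu) (hY : 𝔉.IdentifiesPiY T ι)
    (hχ : 𝔉.CyclotomicCharacterCompat T ι m) (x : 𝔉.EPiN) :
    ((𝔉.envHom H T ι m hY hχ x).right : T.PiX) = ι x.1.2 := rfl

/-- **`E^Π_N → Π^tp_Y[μ_N]` is bijective** (inverse `(a, p) ↦ (m⁻¹(a) · s^⊓-gp_N(ρ(ι⁻¹ p)), ι⁻¹ p)`).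
[cite: MochizukiEtTh2009, Lem 5.9 (iv) p.332 (PDF p.106)] -/
theorem envHom_bijective (H : 𝔉.Facts) (T : ThetaEnvData.{v} 𝔉.N) (ι : 𝔉.PiX ≃* T.PiX)
    (m : 𝔉.muTorsion 𝔉.BN 𝔉.N ≃* T.mu) (hY : 𝔉.IdentifiesPiY T ι)
    (hχ : 𝔉.CyclotomicCharacterCompat T ι m) : Function.Bijective (𝔉.envHom H T ι m hY hχ) := by
  constructor
  · intro a b hab
    have hr : ι a.1.2 = ι b.1.2 := by
      have := congrArg (fun z : T.env => (z.right : T.PiX)) hab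
      exact this
    have hy : a.1.2 = b.1.2 := ι.injective hr
    have hl : m (𝔉.unitPart H a) = m (𝔉.unitPart H b) := congrArg (fun z : T.env => z.left) hab
    have hu : (𝔉.unitPart H a : Aut 𝔉.BN) = 𝔉.unitPart H b := congrArg Subtype.val (m.injective hl)
    simp only [coe_unitPart, hy] at hu
    have he : a.1.1 = b.1.1 := mul_right_cancel hu
    exact Subtype.ext (Prod.ext he hy)
  · intro z
    set y : 𝔉.PiX := ι.symm (z.right : T.PiX) with hydef
    have hy : y ∈ 𝔉.PiY := (hY y).mpr (by simp [hydef])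
    set u : 𝔉.muTorsion 𝔉.BN 𝔉.N := m.symm z.left with hudef
    have h1 : (u : Aut 𝔉.BN) * 𝔉.sgpCap (𝔉.ρ y) ∈ 𝔉.EN :=
      𝔉.EN.mul_mem (le_sectionSubgroup _ _ _ u.2) (𝔉.sgpCap_rho_mem_EN hy)
    have h2 : 𝔉.autBase 𝔉.BN ((u : Aut 𝔉.BN) * 𝔉.sgpCap (𝔉.ρ y)) = 𝔉.ρ y := by
      have hk := 𝔉.muTorsion_le_ker 𝔉.BN 𝔉.N u.2
      rw [MonoidHom.mem_ker] at hk
      rw [map_mul, hk, one_mul, H.sgpCapSection]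
    let x : 𝔉.EPiN := ⟨((u : Aut 𝔉.BN) * 𝔉.sgpCap (𝔉.ρ y), y), ⟨h1, hy, h2⟩⟩
    have hux : 𝔉.unitPart H x = u := Subtype.ext (by simp [x])
    refine ⟨x, ?_⟩
    ext
    · change m (𝔉.unitPart H x) = z.left
      rw [hux, hudef, MulEquiv.apply_symm_apply]
    · change ι y = (z.right : T.PiX)
      rw [hydef, MulEquiv.apply_symm_apply]

/-- **[EtTh] Lemma 5.9 (iv), group isomorphism PROVED**: `E^Π_N ⥲ Π^tp_Y[μ_N]` (modulo `Facts`,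
`IdentifiesPiY`, `CyclotomicCharacterCompat`).  [cite: MochizukiEtTh2009, Lem 5.9 (iv) p.332 (PDF p.106)] -/
noncomputable def envIso (H : 𝔉.Facts) (T : ThetaEnvData.{v} 𝔉.N) (ι : 𝔉.PiX ≃* T.PiX)
    (m : 𝔉.muTorsion 𝔉.BN 𝔉.N ≃* T.mu) (hY : 𝔉.IdentifiesPiY T ι)
    (hχ : 𝔉.CyclotomicCharacterCompat T ι m) : 𝔉.EPiN ≃* T.env :=
  MulEquiv.ofBijective (𝔉.envHom H T ι m hY hχ) (𝔉.envHom_bijective H T ι m hY hχ)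

/-- Compatibility with the projections: `proj ∘ envIso = ι ∘ (E^Π_N ↠ Π^tp_Y̲)`.
[cite: MochizukiEtTh2009, Lem 5.9 (iv) p.332 (PDF p.106)] -/
theorem envIso_proj (H : 𝔉.Facts) (T : ThetaEnvData.{v} 𝔉.N) (ι : 𝔉.PiX ≃* T.PiX)
    (m : 𝔉.muTorsion 𝔉.BN 𝔉.N ≃* T.mu) (hY : 𝔉.IdentifiesPiY T ι)
    (hχ : 𝔉.CyclotomicCharacterCompat T ι m) (x : 𝔉.EPiN) :
    ((CycEnvelope.proj T.augY T.chi (𝔉.envIso H T ι m hY hχ x) : T.PiY) : T.PiX) = ι (𝔉.toPiY x) :=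
  rfl

/-- Compatibility with the inclusions of the cyclotomes: `envIso (u, 1) = inMu (m u)` ("the natural
inclusion `μ_N(B_N) ↪ E_N`" goes to `μ_N ↪ Π^tp_Y[μ_N]`).  [cite: MochizukiEtTh2009, Lem 5.9 (iv) p.332 (PDF p.106)] -/
theorem envIso_muIncl (H : 𝔉.Facts) (T : ThetaEnvData.{v} 𝔉.N) (ι : 𝔉.PiX ≃* T.PiX)
    (m : 𝔉.muTorsion 𝔉.BN 𝔉.N ≃* T.mu) (hY : 𝔉.IdentifiesPiY T ι)
    (hχ : 𝔉.CyclotomicCharacterCompat T ι m) (u : 𝔉.muTorsion 𝔉.BN 𝔉.N) :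
    𝔉.envIso H T ι m hY hχ (𝔉.muIncl u) = CycEnvelope.inMu T.augY T.chi (m u) := by
  have hu : 𝔉.unitPart H (𝔉.muIncl u) = u := Subtype.ext (by simp)
  ext
  · change m (𝔉.unitPart H (𝔉.muIncl u)) = _
    rw [hu]
    rfl
  · change ι (1 : 𝔉.PiX) = ((1 : T.PiY) : T.PiX)
    simp

/-- Compatibility with the algebraic sections: `envIso ∘ s^⊓-Π_N = s^alg ∘ ι` on `Π^tp_Ÿ̲` — the
`s^alg`-half of "isomorphism of mod `N` bi-theta environments" in Lemma 5.9 (iv).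
[cite: MochizukiEtTh2009, Lem 5.9 (iv) p.332 (PDF p.106)] -/
theorem envIso_sCapPi (H : 𝔉.Facts) (T : ThetaEnvData.{v} 𝔉.N) (ι : 𝔉.PiX ≃* T.PiX)
    (m : 𝔉.muTorsion 𝔉.BN 𝔉.N ≃* T.mu) (hY : 𝔉.IdentifiesPiY T ι)
    (hχ : 𝔉.CyclotomicCharacterCompat T ι m) (h : 𝔉.PiYdd) :
    𝔉.envIso H T ι m hY hχ (𝔉.sCapPi H.sgpCapSection h) =
      CycEnvelope.algSection T.augY T.chi ⟨ι h, (hY _).mp (𝔉.PiYdd_le h.2)⟩ := by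
  have hu : 𝔉.unitPart H (𝔉.sCapPi H.sgpCapSection h) = 1 := Subtype.ext (by simp)
  ext
  · change m (𝔉.unitPart H _) = _
    rw [hu, map_one]
    rfl
  · rfl

end

end ThetaFrobenioid

end Literature.AnabelianGeometry.EtaleTheta
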